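import Summits.QuantumFields.YangMills.Theorems.UnitScaleTiltProp8ChartDoubleBarDefs
import Summits.QuantumFields.YangMills.Theorems.UnitScaleTiltProp8ChartOneStep
import Literature.Analysis.Calculus.ExpLocalLieSubalgebra
import HarnessLib

/-!
# Route `UnitScaleTilt`, crux K1 «MinimiserStabilityRegPr» (stmt-QuantumFields-19200), leaf V2′ `stub_halvingStep` — pillar P3, RULING g26-№6 re-base (S3):
# **THE DOUBLE-BAR ONE STEP WITH PRINT'S `exp[mean log]` BLOCK FRAMES** ([Balaban1985Averaging] (62), (89)): the engine's factorised one step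
# `Prop8ChartOneStep.norm_conj_emlAvgU_sub_one_le` (which conjugates by the LINEAR comb frame `exp(λ̄)`, `λ̄ = |I|⁻¹Σ Z(Γ^σ_{y→x})`) transferred to the
# frame `v(y) := eml{S(Γ^σ_{y→x})}_{(n,σ)}` — the two frames agree to first order and differ by `O(ℓ²s²)`, so the tube constant stays EXACTLY `L`.

Cell `ym3-torus` (HUMAN RULING D-0037, YM ladder rung R3 — YM₃ on T³ is a rung, not the Clay problem), width seat `ym-ust-19200-w4` gen 3, under OWNER RULING g26-№6
(H-side chart of record := print's double-bar functional; (S1) `vframeU V y := eml` of the stair transporters from `emb y`, (S3) P3a engine re-read).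
`--supports stmt-QuantumFields-19200 --as helper`; def-free, 0 sorry; nothing here is a claim about the stub, the crux, the rung or the mass gap.

THE PRINT.  [Balaban1985Averaging] (62) p. 28: *«v(y) = exp[−iΣ_{x∈B(y)}L^{−d}(1/i) log(R_{0,y}V₁)(Γ_{y,x})]»* — the block frame is the `exp[mean log]` of the
staircase transporters from the block centre; (89) p. 31: *«(\overline{\overline{R(V₀)V₁}})_c = (\overline{R_{0,c₋}V₁})⁻¹Ṽ₁R̄_{0,c}\overline{R_{0,c₊}V₁}»* — the double-bar
average conjugates the single-bar average by the frames at the two ends; at the flat background (`V₀ = 1`, all `R₀ = 1`) its linearisation is the straight tube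
`L·(QY)(c)` ((125) p. 36) with NO comb term — the tree's `linAvg_eq_bondAvg_sub_grad_combMean` read backwards.

WHAT IS PROVED (any complete normed `ℂ`-algebra `𝔸` with `‖1‖ = 1`; `ℓ = (d+2)L`; `s` bounds `‖S(b) − 1‖` on the relevant bonds; `48ℓs ≤ 1`):
* §1 `norm_eml_stair_sub_one_sub_mean_le` — the `exp[mean log]` frame to second order: `‖eml{S(Γ^σ_{y→x})} − 1 − λ̄(y)‖ ≤ 586ℓ²s²`, `‖eml{…} − 1‖ ≤ 16ℓs`
  (the loop-family lemma `norm_eml_loopHolU_sub_one_sub_mean_le` of `…Prop8ChartTransport`, re-read for the staircase family inside the block `y`);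
  `norm_eml_stair_sub_exp_mean_le` — `‖eml{S(Γ)} − exp(λ̄(y))‖ ≤ 587ℓ²s²`.
* §2 ★ `norm_dbar_sub_one_le` — **THE DOUBLE-BAR ONE STEP**: `‖v(c₋)⁻¹·Ū(c)·v(c₊) − 1‖ ≤ L·s + 3800·ℓ²s²` for `‖S(b) − 1‖ ≤ s` on the two-block bonds of `c`
  (`Ū = emlAvgU S`, `v = eml` of the staircase transporters as a unit): the engine's `L·s + 800ℓ²s²` plus the `O(ℓ²s²)` cost of exchanging the linear frame for
  print's — the constant of the first-order term is still EXACTLY `L`, which is what the k-uniform propagation of near-flatness through the levels consumes.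
HONEST SCOPE.  One averaging step, flat background, bookkeeping over the landed engine, in the letters of (S1) ✓`…Prop8ChartDoubleBarDefs` (`vframeU`, `dbarAvgU`;
`coe_vframeU`, `coe_dbarAvgU`); no covariance is used (RULING g26-№7 caveat).  NOT a claim about the mass gap.

References: T. Bałaban, CMP **98** (1985) 17–51 [Balaban1985Averaging] ((62)–(63) p.28, (89) p.31, Prop. 3 (122)–(125) p.36); CMP **109** (1987) 249–301
[Balaban1987RG1] ((0.3)–(0.4) pp.252–253).
-/

noncomputable section

open scoped BigOperators
open NormedSpace

namespace Summit.QuantumFields.YangMills.Theorems.Prop8ChartDoubleBar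

open Literature.MathematicalPhysics.QuantumFieldTheory.Balaban1983to89
open T4Continuum BlockAveraging AveragingRT ExpMeanLog MatrixLog BlockAveragingEMLLinearised
open B10Eq27TorusAxialLog (holT)
open B7TransferAnalyticMean (meanCLM meanCLM_apply)
open BlockAveragingEMLAnalyticMean (norm_eml_one_add_sub_sub_mean_le)
open Summit.QuantumFields.YangMills.Theorems.Prop8Chart

variable {P : Params} {j : ℕ}
variable {𝔸 : Type*} [NormedRing 𝔸] [NormedAlgebra ℂ 𝔸] [CompleteSpace 𝔸] [NormOneClass 𝔸]

/-! ## §1 The `exp[mean log]` block frame to second order -/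

omit [NormedAlgebra ℂ 𝔸] [CompleteSpace 𝔸] in
/-- A staircase transporter of a field within `s` of `1` inside the block `y` is within `4ℓs` of `1` and within `10ℓ²s²` of `1 + Z(Γ)` (`4ℓs ≤ 1`; the staircases
stay in their block and have at most `ℓ = (d+2)L` steps). [cite: Balaban1985Averaging, (122)-(123) p.36; Balaban1987RG1, (0.3) p.252] -/
theorem norm_holT_stair_sub_one_le (hj : j + 1 ≤ P.m + P.K) {S : GaugeField P j 𝔸ˣ} (y : Site P (j + 1)) {s : ℝ} (hs0 : 0 ≤ s)
    (hℓs : 4 * (((P.d + 2) * P.L : ℕ) : ℝ) * s ≤ 1)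
    (hS : ∀ b : PBond P j, blockOf b.src = y → blockOf b.tgt = y → ‖((S b : 𝔸ˣ) : 𝔸) - 1‖ ≤ s) (i : Idx P) :
    ‖((holT S (emb y) (stairWord i.2.1 (off i.1)) : 𝔸ˣ) : 𝔸) - 1‖ ≤ 4 * (((P.d + 2) * P.L : ℕ) : ℝ) * s ∧
      ‖((holT S (emb y) (stairWord i.2.1 (off i.1)) : 𝔸ˣ) : 𝔸) - 1 -
          walkSum (fun b => ((S b : 𝔸ˣ) : 𝔸) - 1) (walk (emb y) (stairWord i.2.1 (off i.1)))‖ ≤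
        10 * (((P.d + 2) * P.L : ℕ) : ℝ) ^ 2 * s ^ 2 := by
  have hℓ1 : 1 ≤ (P.d + 2) * P.L := Nat.one_le_iff_ne_zero.mpr (Nat.mul_ne_zero (by omega) (by have := P.hL.2; omega))
  have hlen : (stairWord i.2.1 (off i.1)).length ≤ (P.d + 2) * P.L := by
    have h := length_walk_stairWord_le (P := P) (emb y) i.2.1 i.1
    rwa [length_walk] at h
  exact norm_holT_sub_one_sub_walkSum_le_of_length_le hs0 hℓ1 hℓs _ _ hlen
    fun st hst => hS st.bond (blockOf_ends_of_mem_stairWalk hj y i.1 i.2.1 st hst).1 (blockOf_ends_of_mem_stairWalk hj y i.1 i.2.1 st hst).2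

/-- **PRINT'S BLOCK FRAME TO SECOND ORDER**: with `λ̄(y) = |I|⁻¹ Σ_{(n,σ,·)} Z(Γ^σ_{y→y+n})` (`Z = S − 1`) and `‖S(b) − 1‖ ≤ s` inside the block `y`, `48ℓs ≤ 1`:
`‖eml{S(Γ^σ_{y→x})} − 1 − λ̄(y)‖ ≤ 586·ℓ²s²` and `‖eml{S(Γ^σ_{y→x})} − 1‖ ≤ 16·ℓs` — the frame (62) agrees with the engine's linear comb frame to first order.
[cite: Balaban1985Averaging, (62) p.28, (123) p.36; Balaban1987RG1, (0.4)-(0.8) p.253] -/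
theorem norm_vframeU_sub_one_sub_combMean_le (hj : j + 1 ≤ P.m + P.K) {S : GaugeField P j 𝔸ˣ} (y : Site P (j + 1)) {s : ℝ} (hs0 : 0 ≤ s)
    (hℓs : 48 * (((P.d + 2) * P.L : ℕ) : ℝ) * s ≤ 1)
    (hS : ∀ b : PBond P j, blockOf b.src = y → blockOf b.tgt = y → ‖((S b : 𝔸ˣ) : 𝔸) - 1‖ ≤ s) :
    ‖((vframeU S y : 𝔸ˣ) : 𝔸) - 1 -
        ((Fintype.card (Idx P) : ℂ))⁻¹ • ∑ i : Idx P, walkSum (fun b => ((S b : 𝔸ˣ) : 𝔸) - 1) (walk (emb y) (stairWord i.2.1 (off i.1)))‖ ≤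
        586 * (((P.d + 2) * P.L : ℕ) : ℝ) ^ 2 * s ^ 2 ∧
      ‖((vframeU S y : 𝔸ˣ) : 𝔸) - 1‖ ≤ 16 * (((P.d + 2) * P.L : ℕ) : ℝ) * s := by
  rw [coe_vframeU]
  set ℓ : ℝ := (((P.d + 2) * P.L : ℕ) : ℝ) with hℓ
  have hℓ0 : 0 ≤ ℓ := Nat.cast_nonneg _
  have h4 : 4 * ℓ * s ≤ 1 := by nlinarith [mul_nonneg hℓ0 hs0]
  set θ : ℝ := 4 * ℓ * s with hθ
  have hθ0 : 0 ≤ θ := by positivity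
  have hθ12 : θ ≤ 1 / 12 := by rw [hθ]; nlinarith [mul_nonneg hℓ0 hs0]
  set V : Idx P → 𝔸 := fun i => ((holT S (emb y) (stairWord i.2.1 (off i.1)) : 𝔸ˣ) : 𝔸) - 1 with hV
  have hVi : ∀ i, ‖V i‖ ≤ θ := fun i => (norm_holT_stair_sub_one_le hj y hs0 h4 hS i).1
  have hVn : ‖V‖ ≤ θ := (pi_norm_le_iff_of_nonneg hθ0).2 hVi
  have hW : (fun i : Idx P => ((holT S (emb y) (stairWord i.2.1 (off i.1)) : 𝔸ˣ) : 𝔸)) = 1 + V := by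
    funext i; simp [hV]
  have heml := norm_eml_one_add_sub_sub_mean_le (ι := Idx P) (𝔸 := 𝔸) (V := V) (hVn.trans hθ12)
  rw [meanCLM_apply] at heml
  have heml' : ‖eml (1 + V) - 1 - ((Fintype.card (Idx P) : ℂ))⁻¹ • ∑ i, V i‖ ≤ 36 * θ ^ 2 :=
    heml.trans (by nlinarith [pow_le_pow_left₀ (norm_nonneg V) hVn 2])
  have herr : ‖((Fintype.card (Idx P) : ℂ))⁻¹ • ∑ i, V i -
      ((Fintype.card (Idx P) : ℂ))⁻¹ • ∑ i : Idx P, walkSum (fun b => ((S b : 𝔸ˣ) : 𝔸) - 1) (walk (emb y) (stairWord i.2.1 (off i.1)))‖ ≤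
      10 * ℓ ^ 2 * s ^ 2 := by
    rw [← smul_sub, ← Finset.sum_sub_distrib]
    exact norm_card_inv_smul_sum_le (by positivity) fun i => (norm_holT_stair_sub_one_le hj y hs0 h4 hS i).2
  rw [hW]
  constructor
  · have e : eml (1 + V) - 1 - ((Fintype.card (Idx P) : ℂ))⁻¹ • ∑ i : Idx P,
          walkSum (fun b => ((S b : 𝔸ˣ) : 𝔸) - 1) (walk (emb y) (stairWord i.2.1 (off i.1))) =
        (eml (1 + V) - 1 - ((Fintype.card (Idx P) : ℂ))⁻¹ • ∑ i, V i) +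
          (((Fintype.card (Idx P) : ℂ))⁻¹ • ∑ i, V i -
            ((Fintype.card (Idx P) : ℂ))⁻¹ • ∑ i : Idx P, walkSum (fun b => ((S b : 𝔸ˣ) : 𝔸) - 1) (walk (emb y) (stairWord i.2.1 (off i.1)))) := by
      abel
    rw [e]
    calc _ ≤ 36 * θ ^ 2 + 10 * ℓ ^ 2 * s ^ 2 := (norm_add_le _ _).trans (add_le_add heml' herr)
      _ = 586 * ℓ ^ 2 * s ^ 2 := by rw [hθ]; ring
  · -- `‖eml(1+V) − 1‖ ≤ ‖mean V‖ + 36θ² ≤ θ + 36θ² ≤ 4θ = 16ℓs`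
    have hmean : ‖((Fintype.card (Idx P) : ℂ))⁻¹ • ∑ i, V i‖ ≤ θ := norm_card_inv_smul_sum_le hθ0 hVi
    have e : eml (1 + V) - 1 = (eml (1 + V) - 1 - ((Fintype.card (Idx P) : ℂ))⁻¹ • ∑ i, V i) + ((Fintype.card (Idx P) : ℂ))⁻¹ • ∑ i, V i := by
      abel
    rw [e]
    calc _ ≤ 36 * θ ^ 2 + θ := (norm_add_le _ _).trans (add_le_add heml' hmean)
      _ ≤ 4 * θ := by nlinarith
      _ = 16 * ℓ * s := by rw [hθ]; ring

/-- **THE TWO FRAMES DIFFER AT SECOND ORDER ONLY**: `‖eml{S(Γ^σ_{y→x})} − exp(λ̄(y))‖ ≤ 587·ℓ²s²` (`48ℓs ≤ 1`): print's `exp[mean log]` frame (62) versus the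
engine's linear comb frame `exp(combMean(S − 1))` of `Prop8ChartOneStep.norm_conj_emlAvgU_sub_one_le`. [cite: Balaban1985Averaging, (62)-(63) p.28] -/
theorem norm_vframeU_sub_exp_combMean_le (hj : j + 1 ≤ P.m + P.K) {S : GaugeField P j 𝔸ˣ} (y : Site P (j + 1)) {s : ℝ} (hs0 : 0 ≤ s)
    (hℓs : 48 * (((P.d + 2) * P.L : ℕ) : ℝ) * s ≤ 1)
    (hS : ∀ b : PBond P j, blockOf b.src = y → blockOf b.tgt = y → ‖((S b : 𝔸ˣ) : 𝔸) - 1‖ ≤ s) :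
    ‖((vframeU S y : 𝔸ˣ) : 𝔸) -
        exp (((Fintype.card (Idx P) : ℂ))⁻¹ • ∑ i : Idx P, walkSum (fun b => ((S b : 𝔸ˣ) : 𝔸) - 1) (walk (emb y) (stairWord i.2.1 (off i.1))))‖ ≤
      587 * (((P.d + 2) * P.L : ℕ) : ℝ) ^ 2 * s ^ 2 := by
  set ℓ : ℝ := (((P.d + 2) * P.L : ℕ) : ℝ) with hℓ
  have hℓ0 : 0 ≤ ℓ := Nat.cast_nonneg _
  set a : 𝔸 := ((Fintype.card (Idx P) : ℂ))⁻¹ • ∑ i : Idx P, walkSum (fun b => ((S b : 𝔸ˣ) : 𝔸) - 1) (walk (emb y) (stairWord i.2.1 (off i.1))) with ha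
  have ha1 : ‖a‖ ≤ ℓ * s := norm_combSum_mean_le_of_block hj y hs0 hS
  have hℓs1 : ℓ * s ≤ 1 := by nlinarith [mul_nonneg hℓ0 hs0]
  have hexp : ‖exp a - 1 - a‖ ≤ (ℓ * s) ^ 2 :=
    (norm_exp_sub_one_sub_le_sq (ha1.trans hℓs1)).2.trans (pow_le_pow_left₀ (norm_nonneg a) ha1 2)
  have hfr := (norm_vframeU_sub_one_sub_combMean_le hj y hs0 hℓs hS).1
  have e : ((vframeU S y : 𝔸ˣ) : 𝔸) - exp a = (((vframeU S y : 𝔸ˣ) : 𝔸) - 1 - a) - (exp a - 1 - a) := by abel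
  rw [e]
  calc _ ≤ 586 * ℓ ^ 2 * s ^ 2 + (ℓ * s) ^ 2 := (norm_sub_le _ _).trans (add_le_add hfr hexp)
    _ = 587 * ℓ ^ 2 * s ^ 2 := by ring


/-- **THE FRAME IS `2ℓs`-CLOSE TO `1`** under the stronger smallness `600ℓs ≤ 1` (`‖v(y) − 1‖ ≤ ‖λ̄(y)‖ + 586ℓ²s² ≤ ℓs + ℓs`). [cite: Balaban1985Averaging, (62) p.28] -/
theorem norm_vframeU_sub_one_le (hj : j + 1 ≤ P.m + P.K) {S : GaugeField P j 𝔸ˣ} (y : Site P (j + 1)) {s : ℝ} (hs0 : 0 ≤ s)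
    (hℓs : 600 * (((P.d + 2) * P.L : ℕ) : ℝ) * s ≤ 1)
    (hS : ∀ b : PBond P j, blockOf b.src = y → blockOf b.tgt = y → ‖((S b : 𝔸ˣ) : 𝔸) - 1‖ ≤ s) :
    ‖((vframeU S y : 𝔸ˣ) : 𝔸) - 1‖ ≤ 2 * (((P.d + 2) * P.L : ℕ) : ℝ) * s := by
  set ℓ : ℝ := (((P.d + 2) * P.L : ℕ) : ℝ) with hℓ
  have hℓ0 : 0 ≤ ℓ := Nat.cast_nonneg _
  have h48 : 48 * ℓ * s ≤ 1 := by nlinarith [mul_nonneg hℓ0 hs0]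
  have h1 := (norm_vframeU_sub_one_sub_combMean_le hj y hs0 h48 hS).1
  have h2 := norm_combSum_mean_le_of_block hj y hs0 hS
  have e : ((vframeU S y : 𝔸ˣ) : 𝔸) - 1 = (((vframeU S y : 𝔸ˣ) : 𝔸) - 1 -
      ((Fintype.card (Idx P) : ℂ))⁻¹ • ∑ i : Idx P, walkSum (fun b => ((S b : 𝔸ˣ) : 𝔸) - 1) (walk (emb y) (stairWord i.2.1 (off i.1)))) +
      ((Fintype.card (Idx P) : ℂ))⁻¹ • ∑ i : Idx P, walkSum (fun b => ((S b : 𝔸ˣ) : 𝔸) - 1) (walk (emb y) (stairWord i.2.1 (off i.1))) := by abel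
  rw [e]
  calc _ ≤ 586 * ℓ ^ 2 * s ^ 2 + ℓ * s := norm_add_le_of_le h1 h2
    _ = (586 * (ℓ * s)) * (ℓ * s) + ℓ * s := by ring
    _ ≤ 1 * (ℓ * s) + ℓ * s := by
        refine add_le_add (mul_le_mul_of_nonneg_right ?_ (mul_nonneg hℓ0 hs0)) le_rfl
        nlinarith [mul_nonneg hℓ0 hs0]
    _ = 2 * ℓ * s := by ring

/-! ## §2 ★ The double-bar one step -/

omit [NormedAlgebra ℂ 𝔸] [CompleteSpace 𝔸] [NormOneClass 𝔸] in
/-- Perturbing the two outer factors of a triple product: `‖(g + E₁)·U·(g′ + E₂) − 1‖ ≤ ‖g·U·g′ − 1‖ + ‖E₁‖‖U‖‖g′‖ + ‖g‖‖U‖‖E₂‖ + ‖E₁‖‖U‖‖E₂‖`. [folklore] -/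
theorem norm_perturb_conj_sub_one_le (g g' U E₁ E₂ : 𝔸) :
    ‖(g + E₁) * U * (g' + E₂) - 1‖ ≤ ‖g * U * g' - 1‖ + ‖E₁‖ * ‖U‖ * ‖g'‖ + ‖g‖ * ‖U‖ * ‖E₂‖ + ‖E₁‖ * ‖U‖ * ‖E₂‖ := by
  have e : (g + E₁) * U * (g' + E₂) - 1 = (g * U * g' - 1) + E₁ * U * g' + g * U * E₂ + E₁ * U * E₂ := by noncomm_ring
  rw [e]
  have h3 : ∀ x z w : 𝔸, ‖x * z * w‖ ≤ ‖x‖ * ‖z‖ * ‖w‖ := fun x z w =>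
    (norm_mul_le _ _).trans (mul_le_mul_of_nonneg_right (norm_mul_le _ _) (norm_nonneg _))
  exact norm_add_le_of_le (norm_add_le_of_le (norm_add_le_of_le le_rfl (h3 E₁ U g')) (h3 g U E₂)) (h3 E₁ U E₂)

omit [NormedAlgebra ℂ 𝔸] [CompleteSpace 𝔸] [NormOneClass 𝔸] in
/-- The norm bookkeeping of the double-bar one step, abstracted: frames `V⁻¹`, `W′` within `587θ²` of the linear frames `exp(∓a)`, the engine's bound
`‖exp(−a)·Ū·exp(a′) − 1‖ ≤ L·s + 800θ²`, and the sizes `‖V⁻¹‖ ≤ 1+32θ`, `‖exp(±a)‖ ≤ 1+2θ`, `‖Ū‖ ≤ 1+17θ`, `θ ≤ 1/48` give `‖V⁻¹·Ū·W′ − 1‖ ≤ L·s + 3800θ²`. [folklore] -/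
theorem dbar_bookkeeping {Vinv eW ea ena U eW' ea' : 𝔸} {Ls θ : ℝ} (hθ0 : 0 ≤ θ) (hθ : θ ≤ 1 / 48)
    (hinv : Vinv * eW = 1) (hexp : ea * ena = 1)
    (hfr : ‖eW - ea‖ ≤ 587 * θ ^ 2) (hfr' : ‖eW' - ea'‖ ≤ 587 * θ ^ 2)
    (hVinv : ‖Vinv‖ ≤ 1 + 32 * θ) (hena : ‖ena‖ ≤ 1 + 2 * θ) (hea' : ‖ea'‖ ≤ 1 + 2 * θ) (hU : ‖U‖ ≤ 1 + 17 * θ)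
    (heng : ‖ena * U * ea' - 1‖ ≤ Ls + 800 * θ ^ 2) :
    ‖Vinv * U * eW' - 1‖ ≤ Ls + 3800 * θ ^ 2 := by
  -- `V⁻¹ − exp(−a) = V⁻¹·(exp a − eml W)·exp(−a)`
  have hE1id : Vinv - ena = Vinv * (ea - eW) * ena := by
    calc Vinv - ena = Vinv * (ea * ena) - (Vinv * eW) * ena := by rw [hinv, hexp, mul_one, one_mul]
      _ = Vinv * (ea - eW) * ena := by noncomm_ring
  have hE1 : ‖Vinv - ena‖ ≤ 1020 * θ ^ 2 := by
    rw [hE1id]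
    have hfr1 : ‖ea - eW‖ ≤ 587 * θ ^ 2 := by rw [norm_sub_rev]; exact hfr
    calc _ ≤ ‖Vinv‖ * ‖ea - eW‖ * ‖ena‖ := (norm_mul_le _ _).trans (mul_le_mul_of_nonneg_right (norm_mul_le _ _) (norm_nonneg _))
      _ ≤ (1 + 32 * θ) * (587 * θ ^ 2) * (1 + 2 * θ) :=
          mul_le_mul (mul_le_mul hVinv hfr1 (norm_nonneg _) (by positivity)) hena (norm_nonneg _) (by positivity)
      _ = ((1 + 32 * θ) * (1 + 2 * θ)) * (587 * θ ^ 2) := by ring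
      _ ≤ (1020 / 587) * (587 * θ ^ 2) := mul_le_mul_of_nonneg_right (by nlinarith) (by positivity)
      _ = 1020 * θ ^ 2 := by ring
  have hdecomp : Vinv * U * eW' = (ena + (Vinv - ena)) * U * (ea' + (eW' - ea')) := by simp only [add_sub_cancel]
  rw [hdecomp]
  refine (norm_perturb_conj_sub_one_le _ _ _ _ _).trans ?_
  have hθ2 : 0 ≤ θ ^ 2 := sq_nonneg θ
  have t1 : ‖Vinv - ena‖ * ‖U‖ * ‖ea'‖ ≤ 1020 * θ ^ 2 * (1 + 17 * θ) * (1 + 2 * θ) :=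
    mul_le_mul (mul_le_mul hE1 hU (norm_nonneg _) (by positivity)) hea' (norm_nonneg _) (by positivity)
  have t2 : ‖ena‖ * ‖U‖ * ‖eW' - ea'‖ ≤ (1 + 2 * θ) * (1 + 17 * θ) * (587 * θ ^ 2) :=
    mul_le_mul (mul_le_mul hena hU (norm_nonneg _) (by positivity)) hfr' (norm_nonneg _) (by positivity)
  have t3 : ‖Vinv - ena‖ * ‖U‖ * ‖eW' - ea'‖ ≤ 1020 * θ ^ 2 * (1 + 17 * θ) * (587 * θ ^ 2) :=
    mul_le_mul (mul_le_mul hE1 hU (norm_nonneg _) (by positivity)) hfr' (norm_nonneg _) (by positivity)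
  have hq : (1 + 17 * θ) * (1 + 2 * θ) ≤ 3 / 2 := by nlinarith
  have hq2 : (1 + 17 * θ) * (587 * θ ^ 2) ≤ 1 / 2 := by
    have hθsq1 : θ ^ 2 ≤ 1 / 2304 := by nlinarith
    nlinarith
  have hs1 : 1020 * θ ^ 2 * (1 + 17 * θ) * (1 + 2 * θ) ≤ 1530 * θ ^ 2 := by
    have : 1020 * θ ^ 2 * (1 + 17 * θ) * (1 + 2 * θ) = (1020 * θ ^ 2) * ((1 + 17 * θ) * (1 + 2 * θ)) := by ring
    rw [this]; nlinarith
  have hs2 : (1 + 2 * θ) * (1 + 17 * θ) * (587 * θ ^ 2) ≤ 881 * θ ^ 2 := by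
    have : (1 + 2 * θ) * (1 + 17 * θ) * (587 * θ ^ 2) = (587 * θ ^ 2) * ((1 + 17 * θ) * (1 + 2 * θ)) := by ring
    rw [this]; nlinarith
  have hs3 : 1020 * θ ^ 2 * (1 + 17 * θ) * (587 * θ ^ 2) ≤ 510 * θ ^ 2 := by
    have : 1020 * θ ^ 2 * (1 + 17 * θ) * (587 * θ ^ 2) = (1020 * θ ^ 2) * ((1 + 17 * θ) * (587 * θ ^ 2)) := by ring
    rw [this]; nlinarith
  linarith

set_option maxHeartbeats 400000 in
/-- ★ **THE DOUBLE-BAR ONE STEP AT THE FLAT BACKGROUND WITH PRINT'S FRAMES.**  Let `‖S(b) − 1‖ ≤ s` on every bond with both ends in the two blocks of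
`c = ⟨y, y′⟩` and `48ℓs ≤ 1` (`ℓ = (d+2)L`); let `v(y) = eml{S(Γ^σ_{y→x})}_{(n,σ)}` be the `exp[mean log]` block frames ((62); units of `𝔸` by `isUnit_eml`).  Then
`‖dbarAvgU S c − 1‖ = ‖v(y)⁻¹·Ū(c)·v(y′) − 1‖ ≤ L·s + 3800·ℓ²s²` — the first-order term has constant EXACTLY `L` (the straight segments; the comb means are conjugated away), as in the
engine's `norm_conj_emlAvgU_sub_one_le`, whose linear frame differs from print's by `≤ 587ℓ²s²` (§1). [cite: Balaban1985Averaging, (62) p.28, (89) p.31, Prop. 3 (122)-(125) p.36] -/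
theorem norm_dbarAvgU_sub_one_le (hj : j + 1 ≤ P.m + P.K) {S : GaugeField P j 𝔸ˣ} (c : PBond P (j + 1)) {s : ℝ} (hs0 : 0 ≤ s)
    (hℓs : 48 * (((P.d + 2) * P.L : ℕ) : ℝ) * s ≤ 1)
    (hS : ∀ b : PBond P j, (blockOf b.src = c.src ∨ blockOf b.src = c.tgt) → (blockOf b.tgt = c.src ∨ blockOf b.tgt = c.tgt) →
      ‖((S b : 𝔸ˣ) : 𝔸) - 1‖ ≤ s) :
    ‖((dbarAvgU S c : 𝔸ˣ) : 𝔸) - 1‖ ≤ (P.L : ℝ) * s + 3800 * (((P.d + 2) * P.L : ℕ) : ℝ) ^ 2 * s ^ 2 := by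
  rw [coe_dbarAvgU, coe_vframeU S c.tgt]
  have hℓ0 : 0 ≤ (((P.d + 2) * P.L : ℕ) : ℝ) := Nat.cast_nonneg _
  have hθ0 : 0 ≤ (((P.d + 2) * P.L : ℕ) : ℝ) * s := mul_nonneg hℓ0 hs0
  have hθ : (((P.d + 2) * P.L : ℕ) : ℝ) * s ≤ 1 / 48 := by nlinarith
  -- block hypotheses at the two ends
  have hSsrc : ∀ b : PBond P j, blockOf b.src = c.src → blockOf b.tgt = c.src → ‖((S b : 𝔸ˣ) : 𝔸) - 1‖ ≤ s :=
    fun b h1 h2 => hS b (Or.inl h1) (Or.inl h2)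
  have hStgt : ∀ b : PBond P j, blockOf b.src = c.tgt → blockOf b.tgt = c.tgt → ‖((S b : 𝔸ˣ) : 𝔸) - 1‖ ≤ s :=
    fun b h1 h2 => hS b (Or.inr h1) (Or.inr h2)
  -- the engine's factorised one step and the comb-mean sizes
  obtain ⟨heng, ha1, ha'1⟩ := norm_conj_emlAvgU_sub_one_le hj c hs0 hℓs hS
  -- the frames vs the linear frames
  have hfr := norm_vframeU_sub_exp_combMean_le hj c.src hs0 hℓs hSsrc
  have hfr' := norm_vframeU_sub_exp_combMean_le hj c.tgt hs0 hℓs hStgt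
  rw [coe_vframeU] at hfr'
  have hW1 := (norm_vframeU_sub_one_sub_combMean_le hj c.src hs0 hℓs hSsrc).2
  have hUbar1 := (norm_emlAvgU_sub_one_sub_lin_le hj c hs0 hℓs hS).2
  -- norms of near-`1` elements
  have near1 : ∀ {x : 𝔸} {t : ℝ}, ‖x - 1‖ ≤ t → ‖x‖ ≤ 1 + t := fun {x t} h =>
    calc ‖x‖ = ‖(x - 1) + 1‖ := by rw [sub_add_cancel]
      _ ≤ ‖x - 1‖ + 1 := norm_add_le_of_le le_rfl (by rw [NormOneClass.norm_one])
      _ ≤ 1 + t := by linarith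
  have hexp1 : ∀ {Y : 𝔸}, ‖Y‖ ≤ (((P.d + 2) * P.L : ℕ) : ℝ) * s → ‖exp Y‖ ≤ 1 + 2 * ((((P.d + 2) * P.L : ℕ) : ℝ) * s) :=
    fun {Y} hY => near1 (((norm_exp_sub_one_sub_le_sq (hY.trans (by linarith))).1).trans (by linarith))
  have hna1 : ‖-(((Fintype.card (Idx P) : ℂ))⁻¹ • ∑ i : Idx P,
      walkSum (fun b => ((S b : 𝔸ˣ) : 𝔸) - 1) (walk (emb c.src) (stairWord i.2.1 (off i.1))))‖ ≤ (((P.d + 2) * P.L : ℕ) : ℝ) * s := by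
    rw [norm_neg]; exact ha1
  have hVinv : ‖(((vframeU S c.src)⁻¹ : 𝔸ˣ) : 𝔸)‖ ≤ 1 + 32 * ((((P.d + 2) * P.L : ℕ) : ℝ) * s) := by
    have h16 : 16 * (((P.d + 2) * P.L : ℕ) : ℝ) * s ≤ 1 / 2 := by linarith
    have h := norm_inv_sub_one_le_two_mul (u := vframeU S c.src) hW1 h16
    exact (near1 h).trans (by linarith)
  rw [show (3800 : ℝ) * (((P.d + 2) * P.L : ℕ) : ℝ) ^ 2 * s ^ 2 = 3800 * ((((P.d + 2) * P.L : ℕ) : ℝ) * s) ^ 2 by ring]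
  refine dbar_bookkeeping (eW := ((vframeU S c.src : 𝔸ˣ) : 𝔸))
    hθ0 hθ (vframeU S c.src).inv_mul (Literature.Analysis.Calculus.exp_mul_exp_neg _) ?_ ?_ hVinv (hexp1 hna1) (hexp1 ha'1) (near1 hUbar1 |>.trans ?_) ?_
  · rw [mul_pow, ← mul_assoc]; exact hfr
  · rw [mul_pow, ← mul_assoc]; exact hfr'
  · linarith
  · rw [mul_pow, ← mul_assoc]; exact heng

end Summit.QuantumFields.YangMills.Theorems.Prop8ChartDoubleBar

end
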